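import Literature.NumberTheory.Automorphic.SmoothIndRestrictCompact
import Literature.LinearAlgebra.FiniteKernelOperatorTrace
import HarnessLib

/-!
# The trace of an operator on `(Ind_H^G σ)^{K′}` given by a kernel on the finite set `K ⧸ K′` is the diagonal sum of the kernel
# (van Dijk 1972; Bernstein–Zelevinsky 1977 §2.3 — the linear-algebra heart of «`tr Ind(τ)(f) = ∫_K K_f(k,k) dk`»)

Topic `NumberTheory/Automorphic`; namespace `Representation`.  THEOREMS ONLY (no definition, no instance, no notation, no named fact, no `sorry`).  Cell
`pub/hodgecm-mathlib`, line «CMCharIdentityTest» — brick VD-4 (VALUES-ABSTRACT form) of the `stub_vanDijkGL` road (census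
`B-provers/B-p18/g31/CENSUS-VD-vanDijkGL-road.B-p18g31.md`), over ★ VD-1 `Literature.LinearAlgebra.trace_eq_sum_diag_of_eq_kernelOp` and ★ VD-2
`Representation.exists_restrictQuot` ∕ `restrictQuot_injective` ∕ `mem_range_restrictQuot_iff`.

THE STATEMENT.  `G = H · K` (`hGK`), `K′ ≤ K` open, `σ` a representation of `H` on the LINE `k` (a character; `k` any field, `ℂ` in use), `V^{K′}` the `K′`-fixed vectors of ★
`smoothIndRep H σ`, `Y = K ⧸ K′` finite.  If an endomorphism `T` of `V^{K′}` is COMPUTED BY A KERNEL `A : Y → Y → ℂ` —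
`(T φ)(κ) = Σ_{y′} A ⟦κ⟧ y′ · φ(ỹ′)` for all `φ ∈ V^{K′}`, `κ ∈ K` — and the kernel is `(H ∩ K, σ)`-equivariant in its first variable, then
**`tr T = Σ_y A y y`** (`trace_eq_sum_kernel_diag`).  [This is exactly how `π(f)|_{V^{K′}}` = ★ `levelActOp` arises (VD-3: `A ⟦κ⟧ ⟦κ′⟧ = μ_K(K′) · K_f(κ, κ′)`,
`K_f(k₁,k₂) = c ∫_P f(k₁⁻¹ p k₂) τ(p) dp`), and `Σ_y A y y = ∫_K K_f(k,k) dk` (VD-5).]  Proof: transport `T` to the model `R(V^{K′}) ⊆ (Y → ℂ)` (★ VD-2; `R`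
injective by `G = H · K`), where it is the restriction of the ambient kernel operator `Matrix.toLin' (Matrix.of A)`, which maps `Y → ℂ` INTO `R(V^{K′})` (its
values are equivariant, ★ `mem_range_restrictQuot_iff`); then ★ VD-1.
HONEST LABEL: HC_CM is proved only modulo the printed citations (2 remaining named inputs hLiu418, h413) until rung 0 closes; this file is linear algebra on the
induced model and pays no letter by itself.

## References
* [vanDijk1972] G. van Dijk, *Computation of certain induced characters of 𝔭-adic groups*, Math. Ann. 199 (1972), 229–240, Thm. p. 237.
* [BernsteinZelevinsky1977] I. N. Bernstein, A. V. Zelevinsky, *Induced representations of reductive 𝔭-adic groups I*, §2.3.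
* [CartierCorvallis1979] P. Cartier, *Representations of 𝔭-adic groups: a survey*, PSPM 33.1 (1979), §III.3.
-/

set_option autoImplicit false

noncomputable section

open scoped BigOperators

namespace Representation

variable {k : Type*} [Field k] {G : Type*} [Group G] [TopologicalSpace G] [SeparatelyContinuousMul G] (H K : Subgroup G)
  (σ : Representation k H k) (K' : Subgroup G)

omit [TopologicalSpace G] [SeparatelyContinuousMul G] in
/-- A linear map of the line `k` is multiplication by its value at `1`: `σ p z = σ p 1 * z`. [folklore] -/
private theorem apply_eq_apply_one_mul (p : H) (z : k) : σ p z = σ p 1 * z := by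
  rw [mul_comm, ← smul_eq_mul, ← map_smul, smul_eq_mul, mul_one]

variable {H K σ K'} in
/-- **`tr T = Σ_y A y y` for an endomorphism of `(Ind_H^G σ)^{K′}` computed by an `(H ∩ K, σ)`-equivariant kernel `A` on `K ⧸ K′`** (`G = H · K`, `K′ ≤ K` open,
`σ` a character on `ℂ`, `K ⧸ K′` finite).  The values-abstract core of van Dijk's trace formula: with `T = π(f)|_{V^{K′}}` (★ `levelActOp`) and
`A ⟦κ⟧⟦κ′⟧ = μ_K(K′) K_f(κ,κ′)` it reads `tr π(f) = ∫_K K_f(k,k) dk`. [cite: vanDijk1972, Thm. p. 237] [cite: BernsteinZelevinsky1977, §2.3]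
[cite: CartierCorvallis1979, §III.3] -/
theorem trace_eq_sum_kernel_diag [Fintype (↥K ⧸ K'.subgroupOf K)] (hK'o : IsOpen (K' : Set G)) (hK'K : K' ≤ K)
    (hGK : ∀ g : G, ∃ h : H, ∃ κ ∈ K, g = h * κ)
    (T : ↥((smoothIndRep H σ).fixedPoints K') →ₗ[k] ↥((smoothIndRep H σ).fixedPoints K'))
    (A : ↥K ⧸ K'.subgroupOf K → ↥K ⧸ K'.subgroupOf K → k)
    (hA : ∀ (p : K) (hp : (p : G) ∈ H) (κ : K) (y' : ↥K ⧸ K'.subgroupOf K),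
      A (QuotientGroup.mk (p * κ)) y' = σ ⟨(p : G), hp⟩ 1 * A (QuotientGroup.mk κ) y')
    (hT : ∀ (φ : ↥((smoothIndRep H σ).fixedPoints K')) (κ : K),
      ((T φ : ↥((smoothIndRep H σ).fixedPoints K')) : SmoothInd H σ).toFun (κ : G) =
        ∑ y' : ↥K ⧸ K'.subgroupOf K, A (QuotientGroup.mk κ) y' * (φ : SmoothInd H σ).toFun ((Quotient.out y' : K) : G)) :
    LinearMap.trace k _ T = ∑ y : ↥K ⧸ K'.subgroupOf K, A y y := by
  classical
  -- the model `R : V^{K′} ↪ (Y → ℂ)`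
  obtain ⟨R, hR⟩ := exists_restrictQuot H K σ K'
  have hRinj : Function.Injective R := restrictQuot_injective hGK R hR
  have hRout : ∀ (φ : ↥((smoothIndRep H σ).fixedPoints K')) (y : ↥K ⧸ K'.subgroupOf K),
      R φ y = (φ : SmoothInd H σ).toFun ((Quotient.out y : K) : G) := fun φ y => by
    conv_lhs => rw [← Quotient.out_eq y]
    exact hR φ _
  -- the ambient kernel operator lands in `range R` (its values are equivariant)
  have hAmem : LinearMap.range (Matrix.toLin' (Matrix.of A)) ≤ LinearMap.range R := by
    rintro _ ⟨ψ, rfl⟩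
    rw [mem_range_restrictQuot_iff hK'o hK'K hGK R hR]
    intro p hp κ
    rw [Literature.LinearAlgebra.toLin'_of_apply, Literature.LinearAlgebra.toLin'_of_apply, apply_eq_apply_one_mul, Finset.mul_sum]
    refine Finset.sum_congr rfl fun y' _ => ?_
    rw [hA p hp κ y', mul_assoc]
  -- transport `T` along `e : V^{K′} ≃ range R`
  let e : ↥((smoothIndRep H σ).fixedPoints K') ≃ₗ[k] ↥(LinearMap.range R) := LinearEquiv.ofInjective R hRinj
  have htr : LinearMap.trace k _ T = LinearMap.trace k ↥(LinearMap.range R) (e.conj T) := (LinearMap.trace_conj' T e).symm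
  rw [htr]
  refine Literature.LinearAlgebra.trace_eq_sum_diag_of_eq_kernelOp A (LinearMap.range R) hAmem (e.conj T) fun w => ?_
  -- `e.conj T w = R (T (e⁻¹ w))` and `w = R (e⁻¹ w)`
  set φ := e.symm w with hφ
  have hw : (w : ↥K ⧸ K'.subgroupOf K → k) = R φ := by
    have : w = e φ := by rw [hφ, LinearEquiv.apply_symm_apply]
    rw [this]
    rfl
  have hconj : ((e.conj T w : ↥(LinearMap.range R)) : ↥K ⧸ K'.subgroupOf K → k) = R (T φ) := by
    rw [LinearEquiv.conj_apply]
    rfl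
  rw [hconj, hw]
  funext y
  induction y using Quotient.inductionOn with
  | h κ =>
    show R (T φ) (QuotientGroup.mk κ) = Matrix.toLin' (Matrix.of A) (R φ) (QuotientGroup.mk κ)
    rw [hR, hT φ κ, Literature.LinearAlgebra.toLin'_of_apply]
    refine Finset.sum_congr rfl fun y' _ => ?_
    rw [hRout]

end Representation

end
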